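import Mathlib.NumberTheory.LSeries.RiemannZeta
import Mathlib.MeasureTheory.Integral.IntervalIntegral.Basic
import Literature.NumberTheory.LFunctions.RHClassicalEquivalents
import Literature.NumberTheory.LFunctions.GeneralizedRH
import Literature.NumberTheory.LFunctions.DedekindZeta
import Literature.NumberTheory.LFunctions.SelbergClass
import Literature.NumberTheory.LFunctions.AutomorphicGRH
import Literature.NumberTheory.LFunctions.WeilCriterion
import Literature.NumberTheory.LFunctions.Equivalents
import Literature.NumberTheory.LFunctions.RobinCriterion
import Literature.NumberTheory.LFunctions.DeBruijnNewman
import Literature.Analysis.TotalPositivity.PolyaFrequency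
import Literature.Barriers.RiemannHypothesis.MertensDisproof
import HarnessLib
import HarnessLib.Audit
import HarnessLib.Audit.TribunalTags

/-!
# Strong-Hypothesis Library — summit `RiemannHypothesis` (D-0034)

The REGISTRY of known strong hypotheses `H` (open conjectures with `H ⇒ RH` landed or printed) and of
known EQUIVALENT REFORMULATIONS `E` (`E ↔ RH` landed) for the single-problem summit
`RiemannHypothesis` (problem `RiemannHypothesis` = Mathlib's `_root_.RiemannHypothesis`,
`Summits/RiemannHypothesis/RiemannHypothesis/Statement.lean`). Every entry carries
`@[strong_hypothesis "RiemannHypothesis.RiemannHypothesis"]`; the kernel tribunal (`#h21_tribunal`,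
D-0033 T1 rule (a)) probes each registered `H` against a route crux `C` for `H → C`. The bridges
`H → RH` / `H ↔ RH` live summit-side in `Summits/RiemannHypothesis/StrongHypotheses.lean`.

Nothing already in the tree is restated: existing conjecture `def`s are tagged in place with
`attribute [strong_hypothesis …]`; only criteria whose hypothesis side exists in the tree merely as the
right-hand side of an `… ↔ …` named fact (no `def` of its own) are given a name here, VERBATIM the
right-hand side of that fact, so that the landed `_holds` theorem is the bridge by `Iff.rfl`-transport.
Every new `def` is an OPEN statement (docstring `OPEN CONJECTURE — … [status: open]`, CONVENTIONS §4) and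
carries `@[conjecture]` (`HarnessLib.Audit`, as `RiemannHypothesisStrip`, `WeilPositivity`,
`JensenPolyaCriterion` and the style model `Literature.Barriers.PneNP.HardPRGExist` do): each is equivalent
to, or stronger than, RH, so none is dischargeable literature debt and none has a `_holds` to expect.

## Registry

STRICTLY STRONGER than RH (all open):

| `H` | decl | status here | bridge (summit file) | source |
|---|---|---|---|---|
| GRH for Dirichlet `L`-functions | `Literature.NumberTheory.LFunctions.GeneralizedRiemannHypothesis` | existing, tagged | landed: `GeneralizedRiemannHypothesis.riemannHypothesis` (`RHWave0GRHProofs`) | Davenport ch. 20; MV §10.1 |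
| ERH (Dedekind zeta of every number field) | `Literature.NumberTheory.LFunctions.ExtendedRiemannHypothesis` | existing, tagged | landed: `ExtendedRiemannHypothesis.riemannHypothesis_holds` (`DedekindZetaERHProofs`) | Iwaniec–Kowalski §5.10 |
| Grand RH for the Selberg class | `Literature.NumberTheory.LFunctions.SelbergGrandRiemannHypothesis` | existing, tagged | landed: `SelbergGrandRiemannHypothesis.riemannHypothesis` (`SelbergClassRiemannZetaProofs`) | Selberg 1992; Conrey–Ghosh 1993 §1 |
| Grand RH for cuspidal `GL_n/ℚ` | `Literature.NumberTheory.LFunctions.GrandRiemannHypothesisGL` | existing, tagged | landed: `GrandRiemannHypothesisGL.riemannHypothesis` with `automorphicGRH_one_iff_generalizedRiemannHypothesis_holds` (`AutomorphicGRHProofs`) | Iwaniec–Kowalski §5.7 |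
| `M(x) = O(√x)` (Titchmarsh (14.28.2)) | `Literature.Barriers.RiemannHypothesis.MertensHypothesisBigO` | existing, tagged | landed: `riemannHypothesis_of_mertensHypothesisBigO` (`MertensDisproof`) | Titchmarsh §14.28 |
| weak Mertens hypothesis `∫₁^X (M(x)/x)² dx = O(log X)` | `WeakMertensHypothesis` | NEW (stated here) | PRINTED: `Summit.RiemannHypothesis.StrongHypotheses.WeakMertensHypothesisImpliesRiemannHypothesis` | Titchmarsh §14.29 (14.29.1) |

EQUIVALENT REFORMULATIONS (`E ↔ RH`, all landed in the tree; each `E` is itself open):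

| `E` | decl | status here | landed bridge | source |
|---|---|---|---|---|
| strip form | `Literature.NumberTheory.LFunctions.RiemannHypothesisStrip` | existing, tagged | `riemannHypothesis_iff_strip_holds` | MV §10.1 |
| zero-free half-plane `σ > 1/2` | `ZetaZeroFreeHalfPlane` | NEW | `forall_riemannZeta_ne_zero_iff_quasiRiemannHypothesis` + `quasiRiemannHypothesis_one_half_iff_holds` | Davenport ch. 8 |
| all zeros of `Ξ` real (Riemann 1859) | `XiHasOnlyRealZeros` | NEW | `riemannHypothesis_iff_im_eq_zero_of_riemannXiUpper_eq_zero_holds` | Riemann 1859; Titchmarsh §10.1 |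
| de Bruijn–Newman `Λ ≤ 0` | `DeBruijnNewmanLeZero` | NEW | `riemannHypothesis_iff_deBruijnNewmanConst_nonpos` | Newman 1976; Rodgers–Tao 2020 §1 |
| Robin's inequality, `n > 5040` | `RobinHypothesis` | NEW | `robin_iff_holds` | Robin 1984 Thm. 1 |
| Lagarias's inequality | `LagariasInequality` | NEW | `lagarias_iff_holds` | Lagarias 2002 Thm. 1.1 |
| Littlewood `M(x) = O(x^{1/2+ε})` | `MertensLittlewoodBound` | NEW | `riemannHypothesis_iff_mertensFunction_isBigO_holds` | Littlewood 1912; Titchmarsh Thm. 14.25 (C) |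
| von Koch `ψ(x) − x = O(√x log² x)` | `VonKochPsiBound` | NEW | `riemannHypothesis_iff_chebyshevPsi_isBigO_holds` | von Koch 1901; MV Thm. 13.1 |
| Speiser: `ζ'` zero-free in `0 < σ < 1/2` | `SpeiserCondition` | NEW | `speiser_iff_holds` | Speiser 1934; Levinson–Montgomery 1974 |
| Li: `λ_n ≥ 0` | `LiPositivity` | NEW | `li_criterion_holds` | Li 1997 Thm. 1 |
| Nyman–Beurling–Báez-Duarte, `L²(0,∞)` form | `BaezDuarteClosure` | NEW | `baezDuarte_iff_holds` | Báez-Duarte 2003 Thm. 1.1 |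
| Báez-Duarte, Dirichlet-polynomial (Mellin) form | `BaezDuarteDirichletApprox` | NEW | `baezDuarte_dirichlet_iff_holds` | Báez-Duarte 2003 Thm. 1.1; BDBLS 2000 |
| `(γ(n)/n!)` is a Pólya frequency sequence | `XiTaylorPolyaFrequency` | NEW | `riemannHypothesis_iff_isPolyaFrequencySeq_xi` | Katkova 2006 §1 Thm. C |
| Weil positivity | `Literature.NumberTheory.LFunctions.WeilPositivity` | existing, tagged | `weil_criterion_holds` | Weil 1952; Bombieri 2000 Thm. 2 |
| Weil positivity on every cone `K_a` (Yoshida) | `Literature.NumberTheory.LFunctions.UniformWeilPositivity` | existing, tagged | `uniformWeilPositivity_iff weil_criterion_holds` | Yoshida 1992; Bombieri 2000 §4 |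
| Jensen–Pólya hyperbolicity | `Literature.NumberTheory.LFunctions.JensenPolyaCriterion` | existing, tagged | `polya_jensen_holds` | Pólya 1927; GORZ 2019 §1 |

## Deliberately NOT registered

* WEAKER than RH (consequences, not hypotheses): `LindelofHypothesis` (`RHWave0`), `DensityHypothesis`
  (`ZeroCounting`), `NoSiegelZeros` (`RHWave0`), `QuasiRiemannHypothesis σ₀` for `σ₀ > 1/2`
  (`GeneralizedRH`), `BacklundZeroCondition` (`Barriers/…/LindelofBacklund`).
* RH-PRESUPPOSING or ordinate-only statements that do NOT imply RH in the tree's (honest, RH-free) form: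
  `MontgomeryPairCorrelation`, `MontgomeryStrongPairCorrelation`, `GUEHypothesis` (`ZeroStatistics`:
  statements about the ordinates `γ`, "recorded without RH"), the linear-independence hypothesis
  `Literature.Barriers.RiemannHypothesis.ZetaOrdinatesLinearIndependent` (LI, ordinates only) and
  `SimpleZerosConjecture` (`RHWave0`). "RH + simple zeros" / "RH + LI" are conjunctions with RH itself and
  add nothing the tribunal cannot already see through `RiemannHypothesisStrip`; not registered.
* REFUTED hypotheses (would make every probe vacuous): the Mertens conjecture `|M(x)| < √x`
  (`not_mertens_conjecture`, Odlyzko–te Riele 1985), Pólya's and Turán's conjectures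
  (`not_polya_conjecture`, `not_turan_conjecture`), Newman's `Λ < 0` side (Rodgers–Tao 2020).
* Parametrised predicates (not a single `Prop`): `DirichletCharacter.RiemannHypothesis χ`,
  `NumberField.ExtendedRiemannHypothesis K`, `AutomorphicGRH n`, `SelbergDatum.riemannHypothesis`.

## Not yet typeable

* Hilbert–Pólya (a self-adjoint operator whose spectrum is `{γ}`): no operator-with-spectrum-equal-to-zeros
  vocabulary beyond the Berry–Keating barrier file; would be a bare `∃` over an unspecified Hilbert space.
* Connes's trace-formula / Weil positivity on the idele class space in its adelic form (only the
  `ζ`-only additive form `WeilPositivity` is in the tree).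
* de Branges's positivity condition for `E(z) = ξ(1 - 2iz)` (the barrier file `DeBrangesPositivity`
  records the Conrey–Li obstruction, not a clean `Prop` hypothesis).

## Sources (all keys in `lean/references.bib`)

[Titchmarsh1986] §§10.1, 14.25, 14.28–14.29; [DavenportMNT1980] ch. 8, 20; [IwaniecKowalski2004] §§5.7, 5.10;
[ConreyGhosh1993] §1; [KaczorowskiPerelli1999] §1; [Riemann1859]; [Newman1976]; [RodgersTao2020] §1;
[Robin1984] Thm. 1; [Lagarias2002] Thm. 1.1; [Littlewood1912]; [Koch1901]; [Speiser1934]; [Li1997] Thm. 1;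
[BaezDuarte2003] Thm. 1.1; [Katkova2006] §1 Thm. C; [Bombieri2000] Thm. 2; [GORZPNAS2019] §1; [teRiele2016] §3.
-/

noncomputable section

open Complex Filter Asymptotics MeasureTheory
open scoped Real Topology Nat

/-! ## Existing conjecture `def`s, tagged in place (no restatement) -/

attribute [strong_hypothesis "RiemannHypothesis.RiemannHypothesis"]
  Literature.NumberTheory.LFunctions.GeneralizedRiemannHypothesis
  Literature.NumberTheory.LFunctions.ExtendedRiemannHypothesis
  Literature.NumberTheory.LFunctions.SelbergGrandRiemannHypothesis
  Literature.NumberTheory.LFunctions.GrandRiemannHypothesisGL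
  Literature.Barriers.RiemannHypothesis.MertensHypothesisBigO
  Literature.NumberTheory.LFunctions.RiemannHypothesisStrip
  Literature.NumberTheory.LFunctions.WeilPositivity
  Literature.NumberTheory.LFunctions.UniformWeilPositivity
  Literature.NumberTheory.LFunctions.JensenPolyaCriterion

namespace Literature.StrongHypotheses.RiemannHypothesis

open Literature.NumberTheory.LFunctions

/-! ## Strictly stronger, newly stated -/

/-- OPEN CONJECTURE — the **weak (weakened) Mertens hypothesis**: `∫₁^X (M(x)/x)² dx = O(log X)` as
`X → ∞`, `M(x) = ∑_{n ≤ x} μ(n)` (`mertensFunction`, `RHWave0`). Posed in Titchmarsh, *The Theory of the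
Riemann Zeta-Function* (1951/1986), §14.29, eq. (14.29.1), as a hypothesis "less drastic than the Mertens
hypothesis, since it clearly follows from (14.28.2)" [`MertensHypothesisBigO`]; Titchmarsh proves there
that it implies that all complex zeros of `ζ` lie on `σ = 1/2`, that they are simple, and that
`∑ 1/|ρ ζ'(ρ)|²` converges — so it is STRICTLY STRONGER than RH (bridge PRINTED, summit file). Open
(neither proved nor refuted; Ng 2004 studies it under RH + further hypotheses). Written with Mathlib's
interval integral and `IsBigO` along `atTop`; the integrand is a locally bounded step function, so no
integrability side condition is hidden. [cite: Titchmarsh1986, §14.29 eq. (14.29.1)] [status: open] -/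
@[conjecture, strong_hypothesis "RiemannHypothesis.RiemannHypothesis"]
def WeakMertensHypothesis : Prop :=
  (fun X : ℝ ↦ ∫ x in (1 : ℝ)..X, ((mertensFunction x : ℝ) / x) ^ 2) =O[atTop] fun X : ℝ ↦ Real.log X

/-! ## Equivalent reformulations whose hypothesis side had no name in the tree

Each `def` below is VERBATIM the right-hand side of the cited `… ↔ …` named fact of
`Literature/NumberTheory/LFunctions/`, whose `_holds` discharge is the landed bridge. -/

/-- OPEN CONJECTURE (equivalent to RH) — **zero-free half-plane form**: `ζ(s) ≠ 0` for every `s` with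
`re s > 1/2` ("`ℒ(s) ≠ 0` for `σ > 1/2`", the wording of the Grand RH in Steuding 2007 §6.1 quoted in
`SelbergClassRiemannZetaProofs`; Davenport ch. 8). Mathlib's `riemannZeta` is total and `ζ(1) ≠ 0`
(`riemannZeta_one_ne_zero`), so no junk value interferes. Equivalent to `RiemannHypothesis` by
`forall_riemannZeta_ne_zero_iff_quasiRiemannHypothesis (1/2)` (`NymanBeurling`) and
`quasiRiemannHypothesis_one_half_iff_holds` (`GeneralizedRH`). [cite: DavenportMNT1980, ch. 8] [status: open] -/
@[conjecture, strong_hypothesis "RiemannHypothesis.RiemannHypothesis"]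
def ZetaZeroFreeHalfPlane : Prop :=
  ∀ s : ℂ, 1 / 2 < s.re → riemannZeta s ≠ 0

/-- OPEN CONJECTURE (equivalent to RH) — **Riemann's own formulation**: every zero of
`Ξ(z) = ξ(1/2 + iz)` (`riemannXiUpper`, `RiemannXi`) is real ("es ist sehr wahrscheinlich, dass alle
Wurzeln reelle sind", Riemann 1859; Titchmarsh §10.1). Stated through the tree's predicate
`HasOnlyRealZeros` (`DeBruijnNewman`); definitionally the right-hand side of
`riemannHypothesis_iff_im_eq_zero_of_riemannXiUpper_eq_zero` (`RiemannXi`), discharged in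
`RiemannXiProofs`. [cite: Riemann1859, statement "alle Wurzeln reelle sind" (Titchmarsh1986 §10.1)] [status: open] -/
@[conjecture, strong_hypothesis "RiemannHypothesis.RiemannHypothesis"]
def XiHasOnlyRealZeros : Prop :=
  HasOnlyRealZeros riemannXiUpper

/-- OPEN CONJECTURE (equivalent to RH) — **de Bruijn–Newman**: `Λ ≤ 0` for the de Bruijn–Newman
constant `Λ = deBruijnNewmanConst` (`DeBruijnNewman`). Newman 1976 (with the conjecture `Λ ≥ 0`, now
the Rodgers–Tao theorem, so RH `↔ Λ = 0`); Rodgers–Tao 2020 §1. Landed equivalence: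
`riemannHypothesis_iff_deBruijnNewmanConst_nonpos` (`DeBruijnNewmanConstProofs`).
[cite: NewmanPAMS1976, Thm. 3 and the remark following it] [status: open] -/
@[conjecture, strong_hypothesis "RiemannHypothesis.RiemannHypothesis"]
def DeBruijnNewmanLeZero : Prop :=
  deBruijnNewmanConst ≤ 0

/-- OPEN CONJECTURE (equivalent to RH) — **Robin's inequality for every `n > 5040`**:
`σ(n) < e^γ n log log n` (`robinInequality`, `RobinCriterion`). Robin 1984, Thm. 1: RH holds iff this
does; landed as `robin_iff_holds` (`RHClassicalEquivalentsRobinProofs`), whose right-hand side this is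
(through `robin_iff_iff`). [cite: Robin1984, Thm. 1] [status: open] -/
@[conjecture, strong_hypothesis "RiemannHypothesis.RiemannHypothesis"]
def RobinHypothesis : Prop :=
  ∀ n : ℕ, 5040 < n → robinInequality n

/-- OPEN CONJECTURE (equivalent to RH) — **Lagarias's inequality**: `σ(n) ≤ H_n + exp(H_n) log(H_n)` for
every `n ≥ 1`, `H_n = harmonic n`. Lagarias 2002, Thm. 1.1; landed as `lagarias_iff_holds`
(`RHClassicalEquivalentsRobinProofs`), whose right-hand side this is verbatim.
[cite: Lagarias2002, Thm. 1.1] [status: open] -/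
@[conjecture, strong_hypothesis "RiemannHypothesis.RiemannHypothesis"]
def LagariasInequality : Prop :=
  ∀ n : ℕ, 1 ≤ n →
    (ArithmeticFunction.sigma 1 n : ℝ) ≤
      (harmonic n : ℝ) + Real.exp (harmonic n) * Real.log (harmonic n)

/-- OPEN CONJECTURE (equivalent to RH) — **Littlewood's criterion**: `M(x) = O_ε(x^{1/2+ε})` for every
`ε > 0`. Littlewood 1912; Titchmarsh Thm. 14.25 (C); landed as
`riemannHypothesis_iff_mertensFunction_isBigO_holds` (`MertensBoundRH`), whose right-hand side this is
verbatim. [cite: Littlewood1912, Théorème (Titchmarsh Thm 14.25 C)] [status: open] -/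
@[conjecture, strong_hypothesis "RiemannHypothesis.RiemannHypothesis"]
def MertensLittlewoodBound : Prop :=
  ∀ ε : ℝ, 0 < ε → (fun x ↦ (mertensFunction x : ℝ)) =O[atTop] fun x ↦ x ^ (1 / 2 + ε)

/-- OPEN CONJECTURE (equivalent to RH) — **von Koch's error term**: `ψ(x) − x = O(x^{1/2} log² x)`,
`ψ = Chebyshev.psi` (Mathlib). von Koch 1901; Montgomery–Vaughan Thm. 13.1 and §15.1 for the converse;
landed as `riemannHypothesis_iff_chebyshevPsi_isBigO_holds` (`RHClassicalEquivalentsVonKochProofs`),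
whose right-hand side this is verbatim. [cite: Koch1901, main theorem (ψ form)] [status: open] -/
@[conjecture, strong_hypothesis "RiemannHypothesis.RiemannHypothesis"]
def VonKochPsiBound : Prop :=
  (fun x ↦ Chebyshev.psi x - x) =O[atTop] fun x ↦ x ^ (1 / 2 : ℝ) * Real.log x ^ 2

/-- OPEN CONJECTURE (equivalent to RH) — **Speiser's condition**: `ζ'` has no zeros in the open
half-strip `0 < re s < 1/2`. Speiser 1934; Levinson–Montgomery 1974 Thm. 1; landed as `speiser_iff_holds`
(`RHClassicalEquivalentsSpeiserProofs`), whose right-hand side this is verbatim.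
[cite: Speiser1934, Satz (via LevinsonMontgomery1974 Thm 1)] [status: open] -/
@[conjecture, strong_hypothesis "RiemannHypothesis.RiemannHypothesis"]
def SpeiserCondition : Prop :=
  ∀ s : ℂ, 0 < s.re → s.re < 1 / 2 → deriv riemannZeta s ≠ 0

/-- OPEN CONJECTURE (equivalent to RH) — **Li positivity**: the Keiper–Li coefficients
`λ_n = keiperLiCoeff n` (`RiemannXi`) satisfy `λ_n ≥ 0` for every `n ≥ 1`. Li 1997, Thm. 1
(Bombieri–Lagarias 1999, Cor. 1); landed as `li_criterion_holds` (`EquivalentsKeiperLiProofs`), whose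
right-hand side this is verbatim. [cite: Li1997, Thm. 1] [status: open] -/
@[conjecture, strong_hypothesis "RiemannHypothesis.RiemannHypothesis"]
def LiPositivity : Prop :=
  ∀ n : ℕ, 1 ≤ n → 0 ≤ keiperLiCoeff n

/-- OPEN CONJECTURE (equivalent to RH) — **Nyman–Beurling–Báez-Duarte closure**: `𝟙_{(0,1]}` lies in the
`L²((0,∞))`-closure of the span of `x ↦ {1/(kx)}`, `k ∈ ℕ`; spelled out with `eLpNorm … 2` exactly as the
right-hand side of `baezDuarte_iff` (`RHClassicalEquivalents`), landed as `baezDuarte_iff_holds`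
(`NymanBeurlingBaezDuarteProofs`). Báez-Duarte 2003, Thm. 1.1 (Nyman 1950 / Beurling 1955 for real
dilations). [cite: BaezDuarte2003, Thm. 1.1] [status: open] -/
@[conjecture, strong_hypothesis "RiemannHypothesis.RiemannHypothesis"]
def BaezDuarteClosure : Prop :=
  ∀ ε : ℝ, 0 < ε → ∃ (N : ℕ) (c : Fin N → ℝ),
    eLpNorm (fun x : ℝ ↦ (Set.Ioc (0 : ℝ) 1).indicator 1 x -
        ∑ k : Fin N, c k * Int.fract (1 / (((k : ℕ) + 1 : ℝ) * x))) 2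
      (volume.restrict (Set.Ioi 0)) < ENNReal.ofReal ε

/-- OPEN CONJECTURE (equivalent to RH) — **Báez-Duarte, Dirichlet-polynomial (Mellin) form**: for every
`ε > 0` some Dirichlet polynomial `A(s) = ∑_{n<N} a_n (n+1)^{-s}` makes
`∫_ℝ |1 − ζ(1/2+it) A(1/2+it)|² dt/(1/4+t²) < ε` (`d_N → 0`); verbatim the right-hand side of
`baezDuarte_dirichlet_iff` (`RHClassicalEquivalents`), landed as `baezDuarte_dirichlet_iff_holds`
(`RHClassicalEquivalentsProofs`). Báez-Duarte 2003 Thm. 1.1 with the Mellin–Plancherel identification of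
Báez-Duarte–Balazard–Landreau–Saias 2000, §1. [cite: BaezDuarte2003, Thm. 1.1] [status: open] -/
@[conjecture, strong_hypothesis "RiemannHypothesis.RiemannHypothesis"]
def BaezDuarteDirichletApprox : Prop :=
  ∀ ε : ℝ, 0 < ε → ∃ (N : ℕ) (a : Fin N → ℂ),
    ∫⁻ t : ℝ, ENNReal.ofReal (‖1 - riemannZeta (1 / 2 + t * Complex.I) *
        ∑ n : Fin N, a n * ((n : ℂ) + 1) ^ (-(1 / 2 + t * Complex.I))‖ ^ 2 / (1 / 4 + t ^ 2)) <
      ENNReal.ofReal ε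

/-- OPEN CONJECTURE (equivalent to RH) — **Katkova's total-positivity form**: the sequence
`(γ(n)/n!)ₙ` of normalised Taylor coefficients of `ξ` at `1/2` (`xiTaylorCoeff`, `RiemannXi`) is a Pólya
frequency sequence (`Literature.Analysis.TotalPositivity.IsPolyaFrequencySeq`), i.e. `ξ₁ ∈ PF_∞`.
Katkova 2006, §1, Thm. C and the sentence following it; landed as
`riemannHypothesis_iff_isPolyaFrequencySeq_xi` (`XiMultiplePositivityProofs`), whose right-hand side this
is verbatim. [cite: Katkova2006, §1 Thm. C] [status: open] -/
@[conjecture, strong_hypothesis "RiemannHypothesis.RiemannHypothesis"]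
def XiTaylorPolyaFrequency : Prop :=
  Literature.Analysis.TotalPositivity.IsPolyaFrequencySeq (fun n => xiTaylorCoeff n / (n ! : ℝ))

end Literature.StrongHypotheses.RiemannHypothesis

end
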